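import Literature.AlgebraicGeometry.Morphisms.SteinOfLocalRing
import Mathlib.RingTheory.LocalProperties.Exactness
import Mathlib.RingTheory.Localization.BaseChange
import Mathlib.RingTheory.Ideal.KrullsHeightTheorem
import Mathlib.RingTheory.Localization.AtPrime.Basic
import HarnessLib

/-!
# Universal Stein property of a proper morphism from its Artin-local base changes

Topic `Literature/AlgebraicGeometry/Morphisms`; theorems only (no definition, no named fact, no
instance). Let `p : Y → S` be proper and suppose that for every Artin local ring `R′` and every
`i : Spec R′ → S` the base change `Y ×_S Spec R′ → Spec R′` is Stein (`R′ ⥲ Γ(Y ×_S Spec R′, 𝒪)`).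
Then for every locally Noetherian `T` and `g : T → S` the base change `π : Y ×_S T → T` satisfies
`Γ(W, 𝒪_T) ⥲ Γ(π⁻¹W, 𝒪)` for every open `W ⊆ T` — «cohomological flatness in dimension `0`» of
[GortzWedhorn2023] Cor. 24.63 / EGA III (7.8.6), obtained here from the Artin levels by the formal
levels theorem over Noetherian local rings (tree `Morphisms/SteinOfLocalRing`), localisation at the
maximal ideals of a Noetherian affine base (flat base change [StacksProject, Tag 02KH] and
[AtiyahMacdonald1969] Prop. 3.9: bijectivity is local), and the sheaf property. The consumer is the
universal Stein property `hStein` of abelian schemes over locally Noetherian bases, whose Artin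
levels are the Artin-local Stein theorem.

* `bijective_algebraMapΓ_snd_of_artinLevels_of_isLocalRing` — Noetherian local affine base;
* `bijective_algebraMapΓ_snd_of_artinLevels` — Noetherian affine base;
* `app_bijective_snd_of_artinLevels` — every open of a locally Noetherian base.

## References
* [GortzWedhorn2023] U. Görtz, T. Wedhorn, *Algebraic Geometry II*, Cor. 24.63, Thm. 24.37.
* [StacksProject] The Stacks Project, Tag 02KH (flat base change, degree 0).
* [AtiyahMacdonald1969] M. Atiyah, I. Macdonald, *Introduction to Commutative Algebra*, Prop. 3.9
  (injectivity/surjectivity is a local property), Cor. 10.19.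
-/

noncomputable section

open CategoryTheory CategoryTheory.Limits AlgebraicGeometry TopologicalSpace Opposite IsLocalRing
open TensorProduct

universe u

namespace Literature.AlgebraicGeometry.Morphisms

open infinitesimalNeighbourhood

/-! ## §0 Plumbing -/

section Plumbing

/-- Along a commutative triangle `z ≫ g = h` over `Spec B`, pulling back global functions sends
`algebraMapΓ g b` to `algebraMapΓ h b`. [folklore] -/
private theorem appTop_algebraMapΓ_triangle {B : Type u} [CommRing B] {Y Z : Scheme.{u}}
    (g : Y ⟶ Spec (.of B)) (h : Z ⟶ Spec (.of B)) (z : Z ⟶ Y) (w : z ≫ g = h) (b : B) :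
    z.appTop.hom (algebraMapΓ g b) = algebraMapΓ h b := by
  subst w
  change (g.appTop ≫ z.appTop).hom ((Scheme.ΓSpecIso (.of B)).inv.hom b) = _
  rw [← Scheme.Hom.comp_appTop]
  rfl

/-- Stein is invariant under an isomorphism over the base. [folklore] -/
private theorem bijective_algebraMapΓ_iso_over {B : Type u} [CommRing B] {P Q : Scheme.{u}}
    (hP : P ⟶ Spec (.of B)) (hQ : Q ⟶ Spec (.of B)) (k : P ≅ Q) (w : k.hom ≫ hQ = hP)
    (h : Function.Bijective (algebraMapΓ hQ)) : Function.Bijective (algebraMapΓ hP) := by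
  have e : (algebraMapΓ hP : B → Γ(P, ⊤)) = k.hom.appTop.hom ∘ algebraMapΓ hQ := by
    funext b
    exact (appTop_algebraMapΓ_triangle hQ hP k.hom w b).symm
  rw [e]
  haveI : IsIso k.hom.appTop := by
    change IsIso (k.hom.app ⊤)
    infer_instance
  exact (ConcreteCategory.bijective_of_isIso k.hom.appTop).comp h

/-- Stein for the base change along `b' ≫ b` gives Stein for the iterated base change (pasting).
[folklore] -/
private theorem bijective_algebraMapΓ_snd_snd {S Y T' : Scheme.{u}} (p : Y ⟶ S) {C : Type u}
    [CommRing C] (b : T' ⟶ S) (b' : Spec (.of C) ⟶ T')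
    (h : Function.Bijective (algebraMapΓ (pullback.snd p (b' ≫ b)))) :
    Function.Bijective (algebraMapΓ (pullback.snd (pullback.snd p b) b')) :=
  bijective_algebraMapΓ_iso_over _ _ (pullbackLeftPullbackSndIso p b b')
    (pullbackLeftPullbackSndIso_hom_snd p b b') h

/-- `algebraMapΓ h` is bijective iff `h.appTop` is. [folklore] -/
private theorem bijective_algebraMapΓ_iff_appTop {B : Type u} [CommRing B] {Z : Scheme.{u}}
    (h : Z ⟶ Spec (.of B)) :
    Function.Bijective (algebraMapΓ h) ↔ Function.Bijective h.appTop := by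
  change Function.Bijective (h.appTop.hom ∘ (Scheme.ΓSpecIso (.of B)).inv.hom) ↔ _
  exact Function.Bijective.of_comp_iff _
    (ConcreteCategory.bijective_of_isIso (Scheme.ΓSpecIso (.of B)).inv)

end Plumbing

/-! ## §1 Noetherian local affine bases -/

section Local

variable {Y S : Scheme.{u}} (p : Y ⟶ S) [IsProper p]
  (hArt : ∀ (R' : Type u) [CommRing R'] [IsArtinianRing R'] [IsLocalRing R']
    (i : Spec (.of R') ⟶ S), Function.Bijective (algebraMapΓ (pullback.snd p i)))

/-- `R/𝔪ⁿ⁺¹` is an Artin local ring for a Noetherian local `(R, 𝔪)`. [folklore] -/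
private theorem isArtinianRing_quotient_maximalIdeal_pow {R : Type u} [CommRing R]
    [IsNoetherianRing R] [IsLocalRing R] (n : ℕ) :
    IsArtinianRing (R ⧸ maximalIdeal R ^ (n + 1)) := by
  apply IsLocalRing.quotient_artinian_of_mem_minimalPrimes_of_isLocalRing
  refine ⟨⟨inferInstance, Ideal.pow_le_self (Nat.succ_ne_zero n)⟩, ?_⟩
  rintro q ⟨hq, hle⟩ -
  haveI := hq
  exact ((Ideal.IsPrime.pow_le_iff (I := maximalIdeal R) (P := q) (Nat.succ_ne_zero n)).mp hle)

/-- `R/𝔪ⁿ⁺¹` is local. [folklore] -/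
private theorem isLocalRing_quotient_maximalIdeal_pow {R : Type u} [CommRing R]
    [IsLocalRing R] (n : ℕ) : IsLocalRing (R ⧸ maximalIdeal R ^ (n + 1)) := by
  have hne : maximalIdeal R ^ (n + 1) ≠ ⊤ := fun h =>
    (maximalIdeal.isMaximal R).ne_top (top_le_iff.mp (h ▸ Ideal.pow_le_self (Nat.succ_ne_zero n)))
  haveI : Nontrivial (R ⧸ maximalIdeal R ^ (n + 1)) := Ideal.Quotient.nontrivial_iff.mpr hne
  exact IsLocalRing.of_surjective' (Ideal.Quotient.mk _) Ideal.Quotient.mk_surjective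

include hArt in
/-- **Noetherian local base.** If all Artin-local base changes of the proper `p : Y → S` are Stein,
then so is every base change to a Noetherian local ring: its infinitesimal levels are Artin-local
base changes of `p` (pasting), and the formal levels theorem (`bijective_algebraMapΓ_of_isLocalRing`)
applies. [cite: GortzWedhorn2023, Thm. 24.37 and Cor. 24.63] -/
theorem bijective_algebraMapΓ_snd_of_artinLevels_of_isLocalRing {R : Type u} [CommRing R]
    [IsNoetherianRing R] [IsLocalRing R] (i : Spec (.of R) ⟶ S) :
    Function.Bijective (algebraMapΓ (pullback.snd p i)) := by
  apply bijective_algebraMapΓ_of_isLocalRing (pullback.snd p i)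
  intro n
  haveI := isArtinianRing_quotient_maximalIdeal_pow (R := R) n
  haveI := isLocalRing_quotient_maximalIdeal_pow (R := R) n
  exact bijective_algebraMapΓ_snd_snd p i (base (maximalIdeal R) n)
    (hArt (R ⧸ maximalIdeal R ^ (n + 1)) (base (maximalIdeal R) n ≫ i))

/-! ## §2 Noetherian affine bases: localisation -/

include hArt in
/-- **Noetherian affine base.** If all Artin-local base changes of the proper `p : Y → S` are
Stein, then so is every base change `X = Y ×_S Spec R → Spec R` to a Noetherian ring `R`: for each
maximal ideal `𝔪`, `X ×_R R_𝔪` is Stein by §1, i.e. (flat base change) `R_𝔪 ⊗_R (R → Γ(X, 𝒪_X))`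
is bijective, and bijectivity of a linear map is local. [cite: StacksProject, Tag 02KH (degree 0)]
[cite: AtiyahMacdonald1969, Prop. 3.9] [cite: GortzWedhorn2023, Cor. 24.63] -/
theorem bijective_algebraMapΓ_snd_of_artinLevels {R : Type u} [CommRing R] [IsNoetherianRing R]
    (i : Spec (.of R) ⟶ S) : Function.Bijective (algebraMapΓ (pullback.snd p i)) := by
  set f := pullback.snd p i
  haveI : CompactSpace (pullback p i : Scheme.{u}) := QuasiCompact.compactSpace_of_compactSpace f
  haveI : QuasiSeparatedSpace (pullback p i : Scheme.{u}) := quasiSeparatedSpace_of_quasiSeparated f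
  set M := Sections f ⊤
  set φ : R →ₗ[R] M := Algebra.linearMap R M
  -- `R_𝔪 ⊗ φ` is bijective for every maximal `𝔪`
  have hloc : ∀ (J : Ideal R) [J.IsMaximal],
      Function.Bijective (φ.lTensor (Localization.AtPrime J)) := by
    intro J _
    rw [← bijective_algebraMapΓ_baseChange_iff_lTensor f]
    exact bijective_algebraMapΓ_snd_snd p i _
      (bijective_algebraMapΓ_snd_of_artinLevels_of_isLocalRing p hArt
        (Spec.map (CommRingCat.ofHom (algebraMap R (Localization.AtPrime J))) ≫ i))
  -- hence `φ` is bijective (bijectivity is local)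
  have hφ : Function.Bijective φ := by
    refine bijective_of_isLocalized_maximal
      (fun J _ => Localization.AtPrime J ⊗[R] R)
      (fun J _ => TensorProduct.mk R (Localization.AtPrime J) R 1)
      (fun J _ => Localization.AtPrime J ⊗[R] M)
      (fun J _ => TensorProduct.mk R (Localization.AtPrime J) M 1) φ ?_
    intro J _
    have e : IsLocalizedModule.map J.primeCompl (TensorProduct.mk R (Localization.AtPrime J) R 1)
        (TensorProduct.mk R (Localization.AtPrime J) M 1) φ =
        (φ.lTensor (Localization.AtPrime J)).restrictScalars R := by
      apply IsLocalizedModule.linearMap_ext J.primeCompl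
        (TensorProduct.mk R (Localization.AtPrime J) R 1)
        (TensorProduct.mk R (Localization.AtPrime J) M 1)
      rw [IsLocalizedModule.map_comp]
      apply LinearMap.ext
      intro r
      rfl
    rw [e]
    exact hloc J
  -- and `algebraMapΓ f` is `φ`
  have e : (algebraMapΓ f : R → Γ(pullback p i, ⊤)) = fun r => (φ r : Γ(pullback p i, ⊤)) := by
    funext r
    change algebraMapΓ f r = algebraMap R (Sections f ⊤) r
    rw [Sections.algebraMap_apply]
    exact (resTop_top _ _).symm
  rw [e]
  exact hφ

end Local

/-! ## §3 Locally Noetherian bases: all opens -/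

section Sheaf

variable {X T : Scheme.{u}} (π : X ⟶ T)

/-- If `Γ(V, 𝒪_T) → Γ(π⁻¹V, 𝒪_X)` is injective for all affine opens `V`, it is injective for every
open `W` (locality of `𝒪_T`). [folklore] -/
private theorem app_injective_of_affine
    (hV : ∀ V : T.affineOpens, Function.Injective (π.app V)) (W : T.Opens) :
    Function.Injective (π.app W) := by
  intro s s' hss'
  -- affine opens inside `W` cover `W`
  let J := {V : T.affineOpens // (V : T.Opens) ≤ W}
  have hcover : W ≤ ⨆ V : J, ((V.1 : T.affineOpens) : T.Opens) := by
    intro x hx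
    obtain ⟨_, ⟨V, hV', rfl⟩, hxV, hVW⟩ := T.isBasis_affineOpens.exists_subset_of_mem_open hx W.2
    exact Opens.mem_iSup.mpr ⟨⟨⟨V, hV'⟩, hVW⟩, hxV⟩
  apply T.sheaf.eq_of_locally_eq' (fun V : J => ((V.1 : T.affineOpens) : T.Opens)) W
    (fun V => homOfLE V.2) hcover
  have hnat : ∀ {A B : T.Opens} (e : B ≤ A) (x : Γ(T, A)),
      π.app B (T.presheaf.map (homOfLE e).op x) =
        X.presheaf.map (homOfLE (π.preimage_mono e)).op (π.app A x) :=
    fun e x => ConcreteCategory.congr_hom (π.naturality (homOfLE e).op) x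
  intro V
  apply hV V.1
  change π.app _ (T.presheaf.map (homOfLE V.2).op s) = π.app _ (T.presheaf.map (homOfLE V.2).op s')
  rw [hnat, hnat, hss']

/-- If `Γ(V, 𝒪_T) → Γ(π⁻¹V, 𝒪_X)` is bijective for all affine opens `V`, it is bijective for every
open `W` (gluing in `𝒪_T` and locality in `𝒪_X`). [folklore] -/
private theorem app_bijective_of_affine
    (hV : ∀ V : T.affineOpens, Function.Bijective (π.app V)) (W : T.Opens) :
    Function.Bijective (π.app W) := by
  have hinj := app_injective_of_affine π (fun V => (hV V).1)
  refine ⟨hinj W, fun t => ?_⟩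
  let J := {V : T.affineOpens // (V : T.Opens) ≤ W}
  let U : J → T.Opens := fun V => ((V.1 : T.affineOpens) : T.Opens)
  have hcover : W ≤ ⨆ V : J, U V := by
    intro x hx
    obtain ⟨_, ⟨V, hV', rfl⟩, hxV, hVW⟩ := T.isBasis_affineOpens.exists_subset_of_mem_open hx W.2
    exact Opens.mem_iSup.mpr ⟨⟨⟨V, hV'⟩, hVW⟩, hxV⟩
  -- local preimages
  choose s hs using fun V : J => (hV V.1).2 (X.presheaf.map (homOfLE (π.preimage_mono V.2)).op t)
  -- naturality of `π^♯` in the form we use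
  have hnat : ∀ {A B : T.Opens} (e : B ≤ A) (x : Γ(T, A)),
      π.app B (T.presheaf.map (homOfLE e).op x) =
        X.presheaf.map (homOfLE (π.preimage_mono e)).op (π.app A x) := by
    intro A B e x
    have h1 := ConcreteCategory.congr_hom (π.naturality (homOfLE e).op) x
    exact h1
  -- compatibility of the local preimages, by injectivity on the intersections
  have hcompat : TopCat.Presheaf.IsCompatible T.sheaf.1 U s := by
    intro V V'
    apply hinj (U V ⊓ U V')
    change π.app _ (T.presheaf.map (homOfLE inf_le_left).op (s V)) =
      π.app _ (T.presheaf.map (homOfLE inf_le_right).op (s V'))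
    rw [hnat inf_le_left (s V), hnat inf_le_right (s V'), hs V, hs V']
    change (X.presheaf.map _ ≫ X.presheaf.map _) t = (X.presheaf.map _ ≫ X.presheaf.map _) t
    rw [← Functor.map_comp, ← Functor.map_comp]
    rfl
  obtain ⟨sW, hsW, -⟩ := T.sheaf.existsUnique_gluing' U W (fun V => homOfLE V.2) hcover s hcompat
  refine ⟨sW, ?_⟩
  -- `π^♯ sW = t` locally on the cover `π⁻¹ U_V` of `π⁻¹ W`
  apply X.sheaf.eq_of_locally_eq' (fun V : J => π ⁻¹ᵁ (U V)) (π ⁻¹ᵁ W)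
    (fun V => homOfLE (π.preimage_mono V.2))
    (by rw [← Scheme.Hom.preimage_iSup]; exact π.preimage_mono hcover)
  intro V
  change X.presheaf.map (homOfLE (π.preimage_mono V.2)).op (π.app W sW) = _
  rw [← hnat V.2 sW]
  change π.app _ (T.sheaf.1.map (homOfLE V.2).op sW) = _
  rw [hsW V, hs V]
  rfl

end Sheaf

section Main

variable {Y S : Scheme.{u}} (p : Y ⟶ S) [IsProper p]
  (hArt : ∀ (R' : Type u) [CommRing R'] [IsArtinianRing R'] [IsLocalRing R']
    (i : Spec (.of R') ⟶ S), Function.Bijective (algebraMapΓ (pullback.snd p i)))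

/-- `Γ(V, 𝒪_T) → Γ(π⁻¹V, 𝒪_X)` is bijective as soon as `(π|_V)^♯` is bijective on global sections.
[folklore] -/
private theorem app_bijective_of_appTop_morphismRestrict {X T : Scheme.{u}} (π : X ⟶ T)
    (V : T.Opens) (h : Function.Bijective (π ∣_ V).appTop) : Function.Bijective (π.app V) := by
  have e := morphismRestrict_appTop π V
  rw [e] at h
  have h' : Function.Bijective
      ((X.presheaf.map (eqToHom (image_morphismRestrict_preimage π V ⊤)).op).hom ∘
        (π.app (V.ι ''ᵁ ⊤)).hom) := h
  have h5 : Function.Bijective (π.app (V.ι ''ᵁ ⊤)) :=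
    (Function.Bijective.of_comp_iff' (ConcreteCategory.bijective_of_isIso
      (X.presheaf.map (eqToHom (image_morphismRestrict_preimage π V ⊤)).op)) _).mp h'
  have key : ∀ V' : T.Opens, V' = V → Function.Bijective (π.app V') →
      Function.Bijective (π.app V) := by
    rintro V' rfl h'; exact h'
  exact key _ (V.ι_image_top) h5

/-- `(π|_V)^♯` is bijective on global sections as soon as the base change of `π` along
`Spec Γ(V, 𝒪_T) → T` is Stein (`π⁻¹V ≅ X ×_T Spec Γ(V)` over `Spec Γ(V) ≅ V`). [folklore] -/
private theorem appTop_morphismRestrict_bijective_of_snd {X T : Scheme.{u}} (π : X ⟶ T)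
    (V : T.Opens) (hV : IsAffineOpen V)
    (h : Function.Bijective (algebraMapΓ (pullback.snd π hV.fromSpec))) :
    Function.Bijective (π ∣_ V).appTop := by
  have s1 := isPullback_morphismRestrict π V
  have s2 : IsPullback hV.isoSpec.hom V.ι hV.fromSpec (𝟙 T) :=
    IsPullback.of_horiz_isIso ⟨by rw [Category.comp_id, ← IsAffineOpen.isoSpec_inv_ι,
      Iso.hom_inv_id_assoc]⟩
  have sq : IsPullback (π ∣_ V ≫ hV.isoSpec.hom) ((π ⁻¹ᵁ V).ι) hV.fromSpec π := by
    have h12 := s1.paste_horiz s2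
    rwa [Category.comp_id] at h12
  have hk : sq.flip.isoPullback.hom ≫ pullback.snd π hV.fromSpec = π ∣_ V ≫ hV.isoSpec.hom :=
    sq.flip.isoPullback_hom_snd
  have h3 : Function.Bijective (algebraMapΓ (π ∣_ V ≫ hV.isoSpec.hom)) :=
    bijective_algebraMapΓ_iso_over _ _ sq.flip.isoPullback hk h
  have e3 : (algebraMapΓ (π ∣_ V ≫ hV.isoSpec.hom) : Γ(T, V) → _) =
      (π ∣_ V).appTop.hom ∘ (hV.isoSpec.hom.appTop.hom ∘ (Scheme.ΓSpecIso Γ(T, V)).inv.hom) := by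
    funext r
    change ((π ∣_ V ≫ hV.isoSpec.hom).appTop.hom.comp (Scheme.ΓSpecIso Γ(T, V)).inv.hom) r = _
    rw [Scheme.Hom.comp_appTop]
    rfl
  rw [e3] at h3
  haveI : IsIso hV.isoSpec.hom.appTop := by
    change IsIso (hV.isoSpec.hom.app ⊤); infer_instance
  exact (Function.Bijective.of_comp_iff _
    ((ConcreteCategory.bijective_of_isIso hV.isoSpec.hom.appTop).comp
      (ConcreteCategory.bijective_of_isIso (Scheme.ΓSpecIso Γ(T, V)).inv))).mp h3

include hArt in
/-- **Affine pieces.** For `g : T → S` and an affine open `V ⊆ T` with `Γ(V, 𝒪_T)` Noetherian,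
`Γ(V, 𝒪_T) → Γ(π⁻¹V, 𝒪)` is bijective for the base change `π : Y ×_S T → T`: the restriction
`π|_V` is the base change of `p` along `Spec Γ(V) ≅ V ⊆ T → S`. [cite: GortzWedhorn2023,
Cor. 24.63] -/
private theorem app_bijective_snd_of_artinLevels_affine {T : Scheme.{u}} (g : T ⟶ S)
    (V : T.Opens) (hV : IsAffineOpen V) [IsNoetherianRing Γ(T, V)] :
    Function.Bijective ((pullback.snd p g).app V) := by
  have h1 := bijective_algebraMapΓ_snd_of_artinLevels p hArt (hV.fromSpec ≫ g)
  have h2 : Function.Bijective (algebraMapΓ (pullback.snd (pullback.snd p g) hV.fromSpec)) :=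
    bijective_algebraMapΓ_snd_snd p g hV.fromSpec h1
  exact app_bijective_of_appTop_morphismRestrict _ V
    (appTop_morphismRestrict_bijective_of_snd _ V hV h2)

include hArt in
/-- **Universal Stein property from the Artin levels.** Let `p : Y → S` be proper and assume that
for every Artin local ring `R′` and every `i : Spec R′ → S` the structure map
`R′ → Γ(Y ×_S Spec R′, 𝒪)` is bijective. Then for every locally Noetherian `T`, every `g : T → S`
and every open `W ⊆ T`, the comorphism `Γ(W, 𝒪_T) → Γ(π⁻¹W, 𝒪)` of the base change
`π : Y ×_S T → T` is bijective. [cite: GortzWedhorn2023, Cor. 24.63 and Thm. 24.37]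
[cite: StacksProject, Tag 02KH (degree 0)] [cite: AtiyahMacdonald1969, Prop. 3.9 and Cor. 10.19] -/
theorem app_bijective_snd_of_artinLevels {T : Scheme.{u}} [IsLocallyNoetherian T] (g : T ⟶ S)
    (W : T.Opens) : Function.Bijective ((pullback.snd p g).app W) := by
  apply app_bijective_of_affine
  intro V
  haveI : IsNoetherianRing Γ(T, (V : T.Opens)) := IsLocallyNoetherian.component_noetherian V
  exact app_bijective_snd_of_artinLevels_affine p hArt g V V.2

end Main

end Literature.AlgebraicGeometry.Morphisms
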